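import Summits.Langlands.Langlands.Theses.HolomorphicShadow

/-!
BC3 birth skeleton — child `WeakExistence` of `HolomorphicShadow.SectorComplement` (stmt-Langlands-14623),
crux-strategist planner-cstrat-stmt-Langlands-14623-r1-0, 2026-08-17.  Named stubs (the ONLY sorries) and
`WeakExistence_of : stubs → WeakExistence` kernel-checked.  Context = the route file's (child restated verbatim from Sketch.lean /
children.json; after the split the `def` is deleted and the namespace line kept, cf. post/).
Cut (= the sibling child's, Cruxes/SectorToLanglands/Lines/birth_WeakExistence.lean, texts identical): W ⟸ W₁ (a SEMISIMPLE a.e.-avatar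
exists: the Shimura-variety / congruence output) ∧ W₂ (automorphic ⇒ de Rham above ℓ for semisimple avatars).
-/

set_option linter.dupNamespace false

namespace Summit.Langlands.Langlands.Theses.HolomorphicShadow

open scoped BigOperators Topology Manifold Classical MeasureTheory ProbabilityTheory Matrix InnerProductSpace ComplexConjugate ContinuousMap
open Filter Set Function TopologicalSpace MeasureTheory

/-- Piece W — weak existence (Buzzard–Gee Conj. 3.2.2, weak form) (pre-split stand-in; byte-identical with children.json). -/
def WeakExistence : Prop :=
  ∀ (K : Type) [Field K] [NumberField K] (n : ℕ) (hcpt : Literature.NumberTheory.Automorphic.isCompact_glFiniteIntegralLevel n K), 0 < n → ∀ π : Literature.NumberTheory.Automorphic.CuspidalAutomorphicRepData n K hcpt, π.1.IsLAlgebraic → ∀ (ℓ : ℕ) [Fact ℓ.Prime] (ι : PadicAlgCl ℓ ≃+* ℂ), ∃ ρ : Literature.NumberTheory.GaloisRepresentations.FramedGaloisRep K (PadicAlgCl ℓ) n, ((∀ᶠ v : IsDedekindDomain.HeightOneSpectrum (NumberField.RingOfIntegers K) in cofinite, ρ.IsUnramifiedAt v) ∧ ∀ (v : IsDedekindDomain.HeightOneSpectrum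 (NumberField.RingOfIntegers K)) (hv : ((ℓ : ℕ) : NumberField.RingOfIntegers K) ∈ v.asIdeal), (Literature.NumberTheory.PAdicHodge.fontainePstAdicCompletion v ℓ hv).IsDeRhamFramed (ρ.toLocal v)) ∧ ∀ᶠ v : IsDedekindDomain.HeightOneSpectrum (NumberField.RingOfIntegers K) in cofinite, SatakeFrobCompatibleAt ι π.1 ρ v


namespace Cruxes.WeakExistence.Birth

/-- **stub W₁ (OPEN: existence of a semisimple a.e.-avatar)**: every L-algebraic cuspidal `π` of `GL_n(𝔸_K)` has, for
all `ℓ, ι`, SOME semisimple `ρ : Γ_K → GL_n(ℚ̄_ℓ)` unramified a.e. and Satake–Frobenius compatible with `π` a.e. — NO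
`p`-adic Hodge clause (HLTT 2016 Thm A + Scholze 2015 V.4.2 for regular algebraic `π` over CM / totally real `K`; open for
irregular `π` — e.g. the `λ = 1/4` Maass forms of this very route, NonRegularWeightBarrier — and for general `K`,
ShimuraVarietyRealizationBarrier). [cite: BuzzardGeeLMS2014, Conj. 3.2.2] [cite: HarrisLanTaylorThorneRMS2016, Thm. A] -/
theorem stub_semisimpleAvatar :
    ∀ (K : Type) [Field K] [NumberField K] (n : ℕ) (hcpt : Literature.NumberTheory.Automorphic.isCompact_glFiniteIntegralLevel n K), 0 < n → ∀ π : Literature.NumberTheory.Automorphic.CuspidalAutomorphicRepData n K hcpt, π.1.IsLAlgebraic → ∀ (ℓ : ℕ) [Fact ℓ.Prime] (ι : PadicAlgCl ℓ ≃+* ℂ), ∃ ρ : Literature.NumberTheory.GaloisRepresentations.FramedGaloisRep K (PadicAlgCl ℓ) n, ρ.toGaloisRep.IsSemisimple ∧ (∀ᶠ v : IsDedekindDomain.HeightOneSpectrum (NumberField.RingOfIntegers K) in cofinite, ρ.IsUnramifiedAt v) ∧ ∀ᶠ v : IsDedekindDomain.HeightOneSpectrum (NumberField.RingOfIntegers K)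 in cofinite, SatakeFrobCompatibleAt ι π.1 ρ v := by
  sorry

/-- **stub W₂ (OPEN: automorphic Galois representations are de Rham)**: every SEMISIMPLE `ρ` unramified a.e. and
Satake–Frobenius compatible a.e. with an L-algebraic cuspidal `π` is de Rham at every `v ∣ ℓ` for Fontaine's pinned datum
(regular algebraic over CM: A'Campo 2024 / Caraiani–Newton 2023 in the crystalline range; open in general).
[cite: FontaineMazurGeometric1995, §1] [cite: BuzzardGeeLMS2014, Conj. 3.2.2] -/
theorem stub_deRhamOfAutomorphic :
    ∀ (K : Type) [Field K] [NumberField K] (n : ℕ) (hcpt : Literature.NumberTheory.Automorphic.isCompact_glFiniteIntegralLevel n K), 0 < n → ∀ π : Literature.NumberTheory.Automorphic.CuspidalAutomorphicRepData n K hcpt, π.1.IsLAlgebraic → ∀ (ℓ : ℕ) [Fact ℓ.Prime] (ι : PadicAlgCl ℓ ≃+* ℂ) (ρ : Literature.NumberTheory.GaloisRepresentations.FramedGaloisRep K (PadicAlgCl ℓ) n), ρ.toGaloisRep.IsSemisimple → (∀ᶠ v : IsDedekindDomain.HeightOneSpectrum (NumberField.RingOfIntegers K) in cofinite, ρ.IsUnramifiedAt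 v) → (∀ᶠ v : IsDedekindDomain.HeightOneSpectrum (NumberField.RingOfIntegers K) in cofinite, SatakeFrobCompatibleAt ι π.1 ρ v) → ∀ (v : IsDedekindDomain.HeightOneSpectrum (NumberField.RingOfIntegers K)) (hv : ((ℓ : ℕ) : NumberField.RingOfIntegers K) ∈ v.asIdeal), (Literature.NumberTheory.PAdicHodge.fontainePstAdicCompletion v ℓ hv).IsDeRhamFramed (ρ.toLocal v) := by
  sorry

/-- **W from its two stubs**: take the semisimple avatar of W₁; it is de Rham above `ℓ` by W₂. -/
theorem WeakExistence_of :
    (∀ (K : Type) [Field K] [NumberField K] (n : ℕ) (hcpt : Literature.NumberTheory.Automorphic.isCompact_glFiniteIntegralLevel n K), 0 < n → ∀ π : Literature.NumberTheory.Automorphic.CuspidalAutomorphicRepData n K hcpt, π.1.IsLAlgebraic → ∀ (ℓ : ℕ) [Fact ℓ.Prime] (ι : PadicAlgCl ℓ ≃+* ℂ), ∃ ρ : Literature.NumberTheory.GaloisRepresentations.FramedGaloisRep K (PadicAlgCl ℓ) n, ρ.toGaloisRep.IsSemisimple ∧ (∀ᶠ v : IsDedekindDomain.HeightOneSpectrum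 (NumberField.RingOfIntegers K) in cofinite, ρ.IsUnramifiedAt v) ∧ ∀ᶠ v : IsDedekindDomain.HeightOneSpectrum (NumberField.RingOfIntegers K) in cofinite, SatakeFrobCompatibleAt ι π.1 ρ v) →
    (∀ (K : Type) [Field K] [NumberField K] (n : ℕ) (hcpt : Literature.NumberTheory.Automorphic.isCompact_glFiniteIntegralLevel n K), 0 < n → ∀ π : Literature.NumberTheory.Automorphic.CuspidalAutomorphicRepData n K hcpt, π.1.IsLAlgebraic → ∀ (ℓ : ℕ) [Fact ℓ.Prime] (ι : PadicAlgCl ℓ ≃+* ℂ) (ρ : Literature.NumberTheory.GaloisRepresentations.FramedGaloisRep K (PadicAlgCl ℓ) n), ρ.toGaloisRep.IsSemisimple → (∀ᶠ v : IsDedekindDomain.HeightOneSpectrum (NumberField.RingOfIntegers K) in cofinite, ρ.IsUnramifiedAt v) → (∀ᶠ v : IsDedekindDomain.HeightOneSpectrum (NumberField.RingOfIntegers K) in cofinite, SatakeFrobCompatibleAt ι π.1 ρ v) → ∀ (v : IsDedekindDomain.HeightOneSpectrum (NumberField.RingOfIntegers K)) (hv : ((ℓ : ℕ) : NumberField.RingOfIntegers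 K) ∈ v.asIdeal), (Literature.NumberTheory.PAdicHodge.fontainePstAdicCompletion v ℓ hv).IsDeRhamFramed (ρ.toLocal v)) →
    WeakExistence := by
  intro h1 h2 K _ _ n hcpt hn π hπ ℓ _ ι
  obtain ⟨ρ, hss, hur, hρ⟩ := h1 K n hcpt hn π hπ ℓ ι
  exact ⟨ρ, ⟨hur, fun v hv => h2 K n hcpt hn π hπ ℓ ι ρ hss hur hρ v hv⟩, hρ⟩

/-- The composition with the stubs plugged in: `WeakExistence` modulo exactly {W₁, W₂}. -/
theorem WeakExistence_of_stubs : WeakExistence :=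
  WeakExistence_of stub_semisimpleAvatar stub_deRhamOfAutomorphic

end Cruxes.WeakExistence.Birth

end Summit.Langlands.Langlands.Theses.HolomorphicShadow
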